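import Literature.Barriers.QuantumAdvantage.LatticeRigiditySynthesis
import Literature.Barriers.QuantumAdvantage.LatticeRigidityInvolutions
import Mathlib.GroupTheory.SpecificGroups.Alternating
import Mathlib.GroupTheory.FiniteAbelian.Basic
import Mathlib.GroupTheory.Subgroup.Centralizer
import HarnessLib

/-!
# Lattice rigidity of the Toffoli+Hadamard gate group — discharge of the barrier fact

`latticeRigidity_finiteImage_holds : latticeRigidity_finiteImage` (the named fact of
`LatticeRigidity.lean`): for `n ≥ 3` and `d < 2ⁿ` every homomorphism
`ρ : O_{2ⁿ}(ℤ[1/2]) →* GL_d(ℂ)` has finite image.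

## The proof formalised here (elementary; NOT the superrigidity assembly)

The docstring of the fact assembles it from `S`-arithmetic superrigidity
[cite: Margulis1991, Ch. VIII Theorems (B), (C)], the Witt index over `ℚ₂` and the minimal
dimensions of representations of `𝔰𝔬_N`.  None of these is within reach of Mathlib, and for the
specific lattice `Γ_N = O_N(ℤ[1/2])`, `N = 2ⁿ ≥ 8`, there is a much shorter road, which we take:

1. (`map_negAt_eq_of_lt`, from `involutions_eq_of_finrank_lt`) the images `ρ (−1)_[i]` of the
   one-level sign changes are commuting involutions of `ℂ^d` permuted by the `ρ P_σ`; since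
   `d < N` they all coincide — a representation of the hyperoctahedral group `(ℤ/2)^N ⋊ S_N` of
   dimension `< N` kills the even sign changes (folklore Clifford theory: the `S_N`-orbit of a
   character `χ_T`, `∅ ≠ T ≠ [N]`, has `C(N,|T|) ≥ N` elements).
2. (`map_permOp_eq_one_of_mem_alternatingGroup`) the Hadamard relation
   `(H⊗H)(I⊗X)(H⊗H) = I⊗Z` inside `Γ_N` (`hadamardBlock_mul_swap_mul_hadamardBlock`) then puts
   the double transposition `(0 1)(2 3)` in the kernel of `ρ ∘ P`; a conjugate and a product give
   a `3`-cycle, all `3`-cycles are conjugate in `S_N`, and they generate `A_N`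
   (`Equiv.Perm.closure_three_cycles_eq_alternating`): `ρ P_σ = 1` for `σ` even.
3. (`finite_range_of_lt`) by Amy–Glaudell–Ross' exact synthesis
   [cite: AmyGlaudellRoss2020, Theorem 5.5] (`closure_agrGenerators_eq_top`) `Γ_N` is generated by
   the sign changes, the permutation matrices and one `H⊗H` block; their images are
   `A = ρ (−1)_[6]`, `1` or `B = ρ P_{(4 5)}`, and `h = ρ (H⊗H)_[0,1,2,3]` — three pairwise commuting
   involutions (disjoint supports; `N ≥ 7` is used here) — so `ρ(Γ_N)` is an abelian group of
   exponent `2` on three generators: finite (of order `≤ 8`).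

Sharpness remarks (not formalised): the defining representation (`d = N`) has infinite image for
`N ≥ 5`; for `N = 4` the group `Γ_4` is finite.
-/

noncomputable section

open Matrix

namespace Literature.Barriers.QuantumAdvantage

/-! ## Assembly: finite image below dimension `N` -/

section Assembly

open Equiv

variable {N d : ℕ} (ρ : dyadicOrthogonalGroup N →* GL (Fin d) ℂ)

/-- Step 1 (the representation-theoretic input).  Under a homomorphism
`ρ : Γ_N → GL_d(ℂ)` with `d < N` all one-level sign changes have the same image:
`ρ (−1)_[i] = ρ (−1)_[j]`; in particular `ρ` kills the even sign changes.
(`involutions_eq_of_finrank_lt` applied to `A_i = ρ (−1)_[i]`, `g_σ = ρ P_σ`.) [folklore] -/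
theorem map_negAt_eq_of_lt (hdN : d < N) (i j : Fin N) : ρ (negAt i) = ρ (negAt j) := by
  let T : dyadicOrthogonalGroup N → Module.End ℂ (Fin d → ℂ) := fun x =>
    Matrix.toLin' ((ρ x : GL (Fin d) ℂ) : Matrix (Fin d) (Fin d) ℂ)
  have hmul : ∀ x y, T (x * y) = T x * T y := fun x y => by
    simp only [T, map_mul, Units.val_mul, Matrix.toLin'_mul]
    rfl
  have hone : T 1 = 1 := by
    simp only [T, map_one, Units.val_one, Matrix.toLin'_one]
    rfl
  have hAA : ∀ i, T (negAt i) * T (negAt i) = 1 := fun i => by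
    rw [← hmul, negAt_mul_self, hone]
  have hcomm : ∀ i j, Commute (T (negAt i)) (T (negAt j)) := fun i j => by
    show _ * _ = _ * _
    rw [← hmul, ← hmul, negAt_comm]
  have hg : ∀ σ : Perm (Fin N), Function.Injective (T (permOp σ)) := fun σ x y hxy => by
    have h1 : T (permOp σ⁻¹) * T (permOp σ) = 1 := by
      rw [← hmul, ← map_mul, inv_mul_cancel, map_one, hone]
    have h2 := congrArg (T (permOp σ⁻¹)) hxy
    rwa [← Module.End.mul_apply, ← Module.End.mul_apply, h1, Module.End.one_apply,
      Module.End.one_apply] at h2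
  have hconj : ∀ (σ : Perm (Fin N)) (i : Fin N),
      T (permOp σ) * T (negAt i) = T (negAt (σ i)) * T (permOp σ) := fun σ i => by
    rw [← hmul, ← hmul, permOp_mul_negAt]
  have hfin : Module.finrank ℂ (Fin d → ℂ) < N := by
    rw [Module.finrank_fin_fun]
    exact hdN
  have key := involutions_eq_of_finrank_lt hfin (fun i => T (negAt i)) hAA hcomm
    (fun σ => T (permOp σ)) hg hconj i j
  exact Units.ext (Matrix.toLin'.injective key)

/-- Step 2.  For `N ≥ 8` and `d < N`, `ρ` kills the permutation matrices of all EVEN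
permutations: the Hadamard relation `(H⊗H) P_{(01)(23)} (H⊗H) = (−1)_[1](−1)_[3]` and Step 1 put
the double transposition `(0 1)(2 3)` in the kernel of `ρ ∘ P`; conjugating by `(3 4)` and
multiplying gives the `3`-cycle `(2 3)(2 4)`, all `3`-cycles are conjugate, and they generate the
alternating group. [folklore] -/
theorem map_permOp_eq_one_of_mem_alternatingGroup (h8 : 8 ≤ N) (hdN : d < N) (σ : Perm (Fin N))
    (hσ : σ ∈ alternatingGroup (Fin N)) : ρ (permOp σ) = 1 := by
  have h4 : 4 ≤ N := le_trans (by norm_num) h8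
  set c := Fin.castLE h8 with hc_def
  have hc0 : Fin.castLE h4 0 = c 0 := Fin.ext rfl
  have hc1 : Fin.castLE h4 1 = c 1 := Fin.ext rfl
  have hc2 : Fin.castLE h4 2 = c 2 := Fin.ext rfl
  have hc3 : Fin.castLE h4 3 = c 3 := Fin.ext rfl
  have hinj : Function.Injective c := Fin.castLE_injective h8
  have hne : ∀ {a b : Fin 8}, a ≠ b → c a ≠ c b := fun h h' => h (hinj h')
  set K := (ρ.comp permOp).ker with hK
  have hKn : K.Normal := MonoidHom.normal_ker _
  -- the double transposition `(0 1)(2 3)` is in the kernel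
  have hτ₀ : swap (c 0) (c 1) * swap (c 2) (c 3) ∈ K := by
    rw [hK, MonoidHom.mem_ker, MonoidHom.comp_apply]
    have hrel := congrArg ρ (hadamardBlock_mul_swap_mul_hadamardBlock h4)
    rw [hc0, hc1, hc2, hc3] at hrel
    simp only [map_mul] at hrel
    have hEE : ρ (negAt (c 3)) * ρ (negAt (c 3)) = 1 := by
      rw [← map_mul, negAt_mul_self, map_one]
    rw [map_negAt_eq_of_lt ρ hdN (c 1) (c 3), hEE] at hrel
    have hKK : ρ (hadamardBlock h4) * ρ (hadamardBlock h4) = 1 := by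
      rw [← map_mul, hadamardBlock_mul_self, map_one]
    have hKinv : (ρ (hadamardBlock h4))⁻¹ = ρ (hadamardBlock h4) := inv_eq_of_mul_eq_one_right hKK
    rw [map_mul, map_mul]
    calc ρ (permOp (swap (c 0) (c 1))) * ρ (permOp (swap (c 2) (c 3)))
        = (ρ (hadamardBlock h4))⁻¹ * (ρ (hadamardBlock h4) *
            (ρ (permOp (swap (c 0) (c 1))) * ρ (permOp (swap (c 2) (c 3)))) *
            ρ (hadamardBlock h4)) * (ρ (hadamardBlock h4))⁻¹ := by group
      _ = 1 := by rw [hrel, mul_one, hKinv, hKK]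
  -- its conjugate `(0 1)(2 4)` and the `3`-cycle `(2 3)(2 4)`
  have hs01 : swap (c 3) (c 4) * swap (c 0) (c 1) * (swap (c 3) (c 4))⁻¹ = swap (c 0) (c 1) := by
    rw [← Equiv.swap_apply_apply, swap_apply_of_ne_of_ne (hne (by decide)) (hne (by decide)),
      swap_apply_of_ne_of_ne (hne (by decide)) (hne (by decide))]
  have hs23 : swap (c 3) (c 4) * swap (c 2) (c 3) * (swap (c 3) (c 4))⁻¹ = swap (c 2) (c 4) := by
    rw [← Equiv.swap_apply_apply, swap_apply_of_ne_of_ne (hne (by decide)) (hne (by decide)),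
      swap_apply_left]
  have hτ₁ : swap (c 0) (c 1) * swap (c 2) (c 4) ∈ K := by
    have h1 := hKn.conj_mem _ hτ₀ (swap (c 3) (c 4))
    rwa [show swap (c 3) (c 4) * (swap (c 0) (c 1) * swap (c 2) (c 3)) * (swap (c 3) (c 4))⁻¹ =
        (swap (c 3) (c 4) * swap (c 0) (c 1) * (swap (c 3) (c 4))⁻¹) *
          (swap (c 3) (c 4) * swap (c 2) (c 3) * (swap (c 3) (c 4))⁻¹) by group, hs01, hs23] at h1
  have hcomm : swap (c 2) (c 3) * swap (c 0) (c 1) = swap (c 0) (c 1) * swap (c 2) (c 3) := by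
    have h1 : swap (c 2) (c 3) * swap (c 0) (c 1) * (swap (c 2) (c 3))⁻¹ = swap (c 0) (c 1) := by
      rw [← Equiv.swap_apply_apply, swap_apply_of_ne_of_ne (hne (by decide)) (hne (by decide)),
        swap_apply_of_ne_of_ne (hne (by decide)) (hne (by decide))]
    conv_rhs => rw [← h1]
    group
  have hγ : swap (c 2) (c 3) * swap (c 2) (c 4) ∈ K := by
    have h1 := K.mul_mem hτ₀ hτ₁
    rwa [show swap (c 0) (c 1) * swap (c 2) (c 3) * (swap (c 0) (c 1) * swap (c 2) (c 4)) =
        swap (c 0) (c 1) * (swap (c 2) (c 3) * swap (c 0) (c 1)) * swap (c 2) (c 4) by group,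
      hcomm, show swap (c 0) (c 1) * (swap (c 0) (c 1) * swap (c 2) (c 3)) * swap (c 2) (c 4) =
        (swap (c 0) (c 1) * swap (c 0) (c 1)) * swap (c 2) (c 3) * swap (c 2) (c 4) by group,
      Equiv.swap_mul_self, one_mul] at h1
  have hγ3 : Perm.IsThreeCycle (swap (c 2) (c 3) * swap (c 2) (c 4)) :=
    Perm.isThreeCycle_swap_mul_swap_same (hne (by decide)) (hne (by decide)) (hne (by decide))
  -- hence every `3`-cycle, hence the alternating group
  have hall : ∀ τ : Perm (Fin N), τ.IsThreeCycle → τ ∈ K := fun τ hτ => by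
    obtain ⟨x, hx⟩ := isConj_iff.1
      (Perm.isConj_iff_cycleType_eq.2 (hγ3.cycleType.trans hτ.cycleType.symm))
    rw [← hx]
    exact hKn.conj_mem _ hγ x
  have hle : alternatingGroup (Fin N) ≤ K := by
    rw [← Perm.closure_three_cycles_eq_alternating]
    exact (Subgroup.closure_le K).2 fun τ hτ => hall τ hτ
  have h1 := hle hσ
  rwa [hK, MonoidHom.mem_ker, MonoidHom.comp_apply] at h1

open scoped IsMulCommutative in
/-- Step 3.  For `N ≥ 8` and `d < N` every homomorphism `ρ : Γ_N → GL_d(ℂ)` has finite image: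
by exact synthesis (`closure_agrGenerators_eq_top`) the image is generated by
`A = ρ (−1)_[6]` (all `ρ (−1)_[i]` agree, Step 1), `B = ρ P_{(4 5)}` (`ρ P_σ ∈ {1, B}`, Step 2) and
`h = ρ (H⊗H)_[0,1,2,3]`, three pairwise commuting involutions (disjoint supports), so it is a
finitely generated abelian group of exponent `2`, hence finite. [folklore] -/
theorem finite_range_of_lt (h8 : 8 ≤ N) (hdN : d < N) : (Set.range ρ).Finite := by
  have h4 : 4 ≤ N := le_trans (by norm_num) h8
  set c := Fin.castLE h8 with hc_def
  have hinj : Function.Injective c := Fin.castLE_injective h8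
  have hne : ∀ {a b : Fin 8}, a ≠ b → c a ≠ c b := fun h h' => h (hinj h')
  set A := ρ (negAt (c 6)) with hA
  set B := ρ (permOp (swap (c 4) (c 5))) with hB
  set h := ρ (hadamardBlock h4) with hh
  -- three commuting involutions
  have hA2 : A * A = 1 := by rw [hA, ← map_mul, negAt_mul_self, map_one]
  have hB2 : B * B = 1 := by rw [hB, ← map_mul, ← map_mul, Equiv.swap_mul_self, map_one, map_one]
  have hh2 : h * h = 1 := by rw [hh, ← map_mul, hadamardBlock_mul_self, map_one]
  have hAB : A * B = B * A := by
    rw [hA, hB, ← map_mul, ← map_mul, negAt_mul_permOp_of_apply_eq]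
    exact swap_apply_of_ne_of_ne (hne (by decide)) (hne (by decide))
  have hAh : A * h = h * A := by
    rw [hA, hh, ← map_mul, ← map_mul, negAt_mul_hadamardBlock_comm h4]
    simp [hc_def]
  have hBh : B * h = h * B := by
    rw [hB, hh, ← map_mul, ← map_mul, permOp_mul_hadamardBlock_comm h4]
    intro j hj
    refine swap_apply_of_ne_of_ne ?_ ?_ <;>
    · intro hj'
      rw [hj', hc_def, Fin.val_castLE] at hj
      simp at hj
  -- images of the generators
  have hneg : ∀ i, ρ (negAt i) = A := fun i => map_negAt_eq_of_lt ρ hdN i (c 6)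
  have hperm : ∀ σ : Perm (Fin N), ρ (permOp σ) = 1 ∨ ρ (permOp σ) = B := fun σ => by
    by_cases hs : Perm.sign σ = 1
    · exact Or.inl (map_permOp_eq_one_of_mem_alternatingGroup ρ h8 hdN σ
        (Perm.mem_alternatingGroup.2 hs))
    · right
      have hs' : Perm.sign σ = -1 := (Int.units_eq_one_or (Perm.sign σ)).resolve_left hs
      have hmem : σ * swap (c 4) (c 5) ∈ alternatingGroup (Fin N) := by
        rw [Perm.mem_alternatingGroup, map_mul, hs', Perm.sign_swap (hne (by decide))]
        decide
      have h1 := map_permOp_eq_one_of_mem_alternatingGroup ρ h8 hdN _ hmem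
      rw [map_mul, map_mul, ← hB] at h1
      calc ρ (permOp σ) = ρ (permOp σ) * B * B := by rw [mul_assoc, hB2, mul_one]
        _ = B := by rw [h1, one_mul]
  -- the image lies in the abelian group generated by `A, B, h`
  set S : Set (GL (Fin d) ℂ) := {A, B, h} with hS
  have hScomm : ∀ x ∈ S, ∀ y ∈ S, x * y = y * x := by
    intro x hx y hy
    simp only [hS, Set.mem_insert_iff, Set.mem_singleton_iff] at hx hy
    rcases hx with rfl | rfl | rfl <;> rcases hy with rfl | rfl | rfl <;>
      first | rfl | exact hAB | exact hAB.symm | exact hAh | exact hAh.symm | exact hBh | exact hBh.symm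
  haveI hcommI : IsMulCommutative (Subgroup.closure S) := Subgroup.isMulCommutative_closure hScomm
  have hsq : ∀ x ∈ Subgroup.closure S, x * x = 1 := fun x hx => by
    induction hx using Subgroup.closure_induction with
    | mem x hx =>
      simp only [hS, Set.mem_insert_iff, Set.mem_singleton_iff] at hx
      rcases hx with rfl | rfl | rfl
      exacts [hA2, hB2, hh2]
    | one => exact one_mul 1
    | mul x y hx hy ihx ihy =>
      have hxy : x * y = y * x := setLike_mul_comm hx hy
      calc x * y * (x * y) = x * (y * x) * y := by group
        _ = x * (x * y) * y := by rw [hxy]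
        _ = (x * x) * (y * y) := by group
        _ = 1 := by rw [ihx, ihy, one_mul]
    | inv x _ ih => rw [← _root_.mul_inv_rev, ih, inv_one]
  have htors : Monoid.IsTorsion (Subgroup.closure S) := fun g => by
    rw [isOfFinOrder_iff_pow_eq_one]
    refine ⟨2, two_pos, ?_⟩
    rw [pow_two]
    exact Subtype.ext (hsq g.1 g.2)
  have hfin : Finite (Subgroup.closure S) := CommGroup.finite_of_fg_torsion _ htors
  have hsub : Set.range ρ ⊆ Subgroup.closure S := by
    rintro _ ⟨M, rfl⟩
    have hM : M ∈ Subgroup.closure (agrGenerators h4) := by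
      rw [closure_agrGenerators_eq_top]
      exact Subgroup.mem_top M
    induction hM using Subgroup.closure_induction with
    | mem x hx =>
      rcases hx with (⟨i, rfl⟩ | ⟨σ, rfl⟩) | hx
      · rw [hneg]
        exact Subgroup.subset_closure (by simp [hS])
      · rcases hperm σ with h1 | h1 <;> rw [h1]
        · exact Subgroup.one_mem _
        · exact Subgroup.subset_closure (by simp [hS])
      · rw [Set.mem_singleton_iff.1 hx]
        exact Subgroup.subset_closure (by simp [hS, hh])
    | one =>
      rw [map_one]
      exact Subgroup.one_mem _
    | mul x y _ _ ihx ihy =>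
      rw [map_mul]
      exact Subgroup.mul_mem _ ihx ihy
    | inv x _ ih =>
      rw [map_inv]
      exact Subgroup.inv_mem _ ih
  exact Set.Finite.subset (Set.toFinite _) hsub

/-- **Discharge of the barrier fact `latticeRigidity_finiteImage`.**  For `n ≥ 3` and `d < 2ⁿ`,
every homomorphism `ρ : O_{2ⁿ}(ℤ[1/2]) →* GL_d(ℂ)` has finite image (of order `≤ 8`, in fact).

The proof formalised here is NOT the `S`-arithmetic superrigidity assembly recorded in the
docstring of the fact [cite: Margulis1991, Ch. VIII Theorems (B) and (C)] — none of whose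
ingredients is available in Mathlib — but an elementary argument special to `Γ_N = O_N(ℤ[1/2])`,
`N = 2ⁿ ≥ 8`: (1) a representation of the hyperoctahedral subgroup `(ℤ/2)^N ⋊ S_N` of dimension
`< N` kills the even sign changes (`involutions_eq_of_finrank_lt`, folklore Clifford theory);
(2) the Hadamard relation `(H⊗H)(I⊗X)(H⊗H) = I⊗Z` then puts a double transposition, hence the
alternating group `A_N`, in the kernel; (3) by Amy–Glaudell–Ross' exact synthesis
[cite: AmyGlaudellRoss2020, Theorem 5.5] `Γ_N` is generated by sign changes, permutation matrices
and one `H⊗H` block, whose images are three commuting involutions. -/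
theorem latticeRigidity_finiteImage_holds : latticeRigidity_finiteImage := by
  intro n hn d hd ρ
  have h8 : 8 ≤ 2 ^ n :=
    calc 8 = 2 ^ 3 := by norm_num
      _ ≤ 2 ^ n := Nat.pow_le_pow_right (by norm_num) hn
  exact finite_range_of_lt ρ h8 hd

end Assembly

end Literature.Barriers.QuantumAdvantage

end
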